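import Mathlib.Analysis.InnerProductSpace.PiL2
import Mathlib.Topology.MetricSpace.ProperSpace
import Mathlib.Analysis.Normed.Module.FiniteDimension
import Literature.Geometry.DiscreteGeometry.KissingNumberThreeProofs
import HarnessLib

/-!
# Route `BrittleRungDescent`, item `MieRung` (stmt-AtomisticToContinuum-10946), VII: the soft
# coordination cap — at most twelve near neighbours in an almost-unit-separated configuration

Support file for the milestone `MieRung` (crystallization on the Mie `(2q, q)` ladder), first
part of the coordination census of Mie ground states (files `…MieRungSoftCap`,
`…MieRungCensus`).  Pure metric geometry of `ℝ³`, from the kissing number `k(3) = 12`, which is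
PROVED in the tree (`Literature.Geometry.DiscreteGeometry.musin2006_kissing_three_holds`,
Schütte–van der Waerden 1953 / Musin 2006):

* `not_thirteen_unit_vectors` — there are no thirteen unit vectors of `ℝ³` at pairwise distance
  `≥ 1` (the kissing number, indexed form);
* `exists_kissing_slack` — **slack in the thirteen-spheres theorem**: there is `δ > 0` such that
  among any thirteen unit vectors two are at distance `< 1 − δ` (compactness of `(S²)¹³`: the
  closed sets "pairwise distance `≥ 1 − 1/(n+1)`" decrease to the empty set);
* `dist_normalize_ge` — radial projection onto the unit sphere of two points of the shell
  `1 − ε ≤ |·| ≤ 1 + ε` at distance `≥ 1 − ε` loses at most `4ε`;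
* `exists_soft_cap` — **the soft coordination cap**: there is `ε₁₂ > 0` such that in every
  configuration of points of `ℝ³` with pairwise distances `≥ 1 − ε₁₂`, every point has AT MOST
  TWELVE others within distance `1 + ε₁₂` (the "soft coordination cap `≤ 12` in the well" that
  the route's crux `MieSoftKissing` lists as an input, here from the plain kissing number, no
  `L12`, no thirteen-spheres-with-margin theorem; the constant is ineffective).

All elementary given `k(3) = 12`; tagged `[folklore]`.
-/

noncomputable section

namespace Summit.AtomisticToContinuum.Crystallization.Theorems.MieRungCoordination

open Literature.Geometry.DiscreteGeometry Metric

/-! ### The kissing number, indexed form -/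

/-- **No thirteen unit vectors of `ℝ³` are pairwise at distance `≥ 1`** (the kissing number
`k(3) = 12`, `musin2006_kissing_three_holds`, applied to the image of `v`). [folklore] -/
theorem not_thirteen_unit_vectors (v : Fin 13 → EuclideanSpace ℝ (Fin 3)) (hn : ∀ i, ‖v i‖ = 1)
    (hd : ∀ i j, i ≠ j → 1 ≤ dist (v i) (v j)) : False := by
  classical
  have hinj : Function.Injective v := fun i j h => by
    by_contra hij
    have := hd i j hij
    rw [h, dist_self] at this
    linarith
  have hcard : (Finset.univ.image v).card = 13 := by
    rw [Finset.card_image_of_injective _ hinj, Finset.card_univ, Fintype.card_fin]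
  have h12 := musin2006_kissing_three_holds (Finset.univ.image v) (fun w hw => by
      obtain ⟨i, -, rfl⟩ := Finset.mem_image.1 hw
      exact hn i) (fun w hw w' hw' hne => by
      obtain ⟨i, -, rfl⟩ := Finset.mem_image.1 hw
      obtain ⟨j, -, rfl⟩ := Finset.mem_image.1 hw'
      exact hd i j fun h => hne (h ▸ rfl))
  omega

/-! ### Slack in the thirteen-spheres theorem (compactness) -/

/-- **Slack in the kissing number.** There is `δ > 0` such that among any thirteen unit vectors
of `ℝ³` some two are at distance `< 1 − δ`.  Compactness: on the compact set `(S²)¹³` the closed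
sets `T_n = {pairwise distances ≥ 1 − 1/(n+1)}` decrease and have empty intersection (a point of
all `T_n` would be thirteen unit vectors pairwise `≥ 1` apart), so some `T_n` misses `(S²)¹³`.
[folklore] -/
theorem exists_kissing_slack : ∃ δ : ℝ, 0 < δ ∧ ∀ v : Fin 13 → EuclideanSpace ℝ (Fin 3),
    (∀ i, ‖v i‖ = 1) → ∃ i j, i ≠ j ∧ dist (v i) (v j) < 1 - δ := by
  set S : Set (Fin 13 → EuclideanSpace ℝ (Fin 3)) :=
    Set.pi Set.univ fun _ => sphere (0 : EuclideanSpace ℝ (Fin 3)) 1 with hS_def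
  have hS : IsCompact S :=
    isCompact_univ_pi fun _ => isCompact_sphere (0 : EuclideanSpace ℝ (Fin 3)) 1
  set t : ℕ → Set (Fin 13 → EuclideanSpace ℝ (Fin 3)) :=
    fun n => {v | ∀ i j, i ≠ j → 1 - 1 / ((n : ℝ) + 1) ≤ dist (v i) (v j)} with ht_def
  have htc : ∀ n, IsClosed (t n) := by
    intro n
    have he : t n = ⋂ i : Fin 13, ⋂ j : Fin 13, {v : Fin 13 → EuclideanSpace ℝ (Fin 3) |
        i ≠ j → 1 - 1 / ((n : ℝ) + 1) ≤ dist (v i) (v j)} := by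
      ext v
      simp [ht_def]
    rw [he]
    refine isClosed_iInter fun i => isClosed_iInter fun j => ?_
    by_cases hij : i = j
    · have : {v : Fin 13 → EuclideanSpace ℝ (Fin 3) |
          i ≠ j → 1 - 1 / ((n : ℝ) + 1) ≤ dist (v i) (v j)} = Set.univ :=
        Set.eq_univ_of_forall fun v h => absurd hij h
      rw [this]
      exact isClosed_univ
    · have : {v : Fin 13 → EuclideanSpace ℝ (Fin 3) |
          i ≠ j → 1 - 1 / ((n : ℝ) + 1) ≤ dist (v i) (v j)} =
          {v | 1 - 1 / ((n : ℝ) + 1) ≤ dist (v i) (v j)} :=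
        Set.ext fun v => ⟨fun h => h hij, fun h _ => h⟩
      rw [this]
      exact isClosed_le continuous_const ((continuous_apply i).dist (continuous_apply j))
  have hanti : ∀ m n : ℕ, m ≤ n → t n ⊆ t m := by
    intro m n hmn v hv i j hij
    have h1 : (1 : ℝ) / ((n : ℝ) + 1) ≤ 1 / ((m : ℝ) + 1) :=
      one_div_le_one_div_of_le (by positivity) (by exact_mod_cast Nat.add_le_add_right hmn 1)
    linarith [hv i j hij]
  have hdir : Directed (fun x1 x2 => x1 ⊇ x2) t :=
    directed_of_isDirected_le fun m n hmn => hanti m n hmn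
  have hst : S ∩ ⋂ n, t n = ∅ := by
    refine Set.eq_empty_iff_forall_notMem.2 fun v hv => ?_
    obtain ⟨hvS, hvt⟩ := hv
    rw [Set.mem_iInter] at hvt
    refine not_thirteen_unit_vectors v (fun i => ?_) (fun i j hij => ?_)
    · simpa [hS_def] using hvS i
    · by_contra hlt
      rw [not_le] at hlt
      obtain ⟨n, hn⟩ := exists_nat_one_div_lt (show 0 < 1 - dist (v i) (v j) by linarith)
      have := hvt n i j hij
      linarith
  obtain ⟨n, hn⟩ := hS.elim_directed_family_closed t htc hst hdir
  refine ⟨1 / ((n : ℝ) + 1), by positivity, fun v hv => ?_⟩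
  have hvS : v ∈ S := by
    simpa [hS_def] using hv
  have hvt : v ∉ t n := fun h => (Set.eq_empty_iff_forall_notMem.1 hn) v ⟨hvS, h⟩
  simp only [ht_def, Set.mem_setOf_eq, not_forall, not_le, exists_prop] at hvt
  obtain ⟨i, j, hij, hlt⟩ := hvt
  exact ⟨i, j, hij, hlt⟩

/-! ### Radial projection -/

/-- **Radial projection loses at most `4ε`.** If `a, b` lie in the shell
`1 − ε ≤ ‖·‖ ≤ 1 + ε` (`0 ≤ ε ≤ 1/4`) and `‖a − b‖ ≥ 1 − ε`, then their radial projections onto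
the unit sphere are at distance `≥ 1 − 4ε`:
`‖a/|a| − b/|b|‖ ≥ (‖a − b‖ − ||a| − |b||)/|a| ≥ (1 − 3ε)/(1 + ε) ≥ 1 − 4ε`. [folklore] -/
theorem dist_normalize_ge {a b : EuclideanSpace ℝ (Fin 3)} {ε : ℝ} (hε0 : 0 ≤ ε) (hε : ε ≤ 1 / 4)
    (ha1 : 1 - ε ≤ ‖a‖) (ha2 : ‖a‖ ≤ 1 + ε) (hb1 : 1 - ε ≤ ‖b‖) (hb2 : ‖b‖ ≤ 1 + ε)
    (hab : 1 - ε ≤ dist a b) :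
    1 - 4 * ε ≤ dist (‖a‖⁻¹ • a) (‖b‖⁻¹ • b) := by
  set ra := ‖a‖ with hra
  set rb := ‖b‖ with hrb
  have hra0 : 0 < ra := by linarith
  have hrb0 : 0 < rb := by linarith
  -- reverse triangle inequality through the intermediate point `ra⁻¹ • b`
  have h1 : dist (ra⁻¹ • a) (ra⁻¹ • b) = ra⁻¹ * dist a b := by
    rw [dist_smul₀, Real.norm_eq_abs, abs_of_pos (inv_pos.2 hra0)]
  have h2 : dist (ra⁻¹ • b) (rb⁻¹ • b) = |ra⁻¹ - rb⁻¹| * rb := by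
    rw [dist_eq_norm, ← sub_smul, norm_smul, Real.norm_eq_abs]
  have h3 : |ra⁻¹ - rb⁻¹| * rb = |rb - ra| * ra⁻¹ := by
    rw [inv_sub_inv hra0.ne' hrb0.ne', abs_div, abs_of_pos (mul_pos hra0 hrb0)]
    field_simp
  have htri : dist (ra⁻¹ • a) (ra⁻¹ • b) ≤
      dist (ra⁻¹ • a) (rb⁻¹ • b) + dist (rb⁻¹ • b) (ra⁻¹ • b) := dist_triangle _ _ _
  rw [dist_comm (rb⁻¹ • b)] at htri
  rw [h1] at htri
  rw [h2, h3] at htri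
  -- `|rb − ra| ≤ 2ε`
  have h4 : |rb - ra| ≤ 2 * ε := abs_le.2 ⟨by linarith, by linarith⟩
  have h5 : ra⁻¹ * dist a b - |rb - ra| * ra⁻¹ ≤ dist (ra⁻¹ • a) (rb⁻¹ • b) := by linarith
  -- `(dist a b − |rb − ra|)/ra ≥ (1 − 3ε)/ra ≥ (1 − 3ε)/(1 + ε) ≥ 1 − 4ε`
  have h6 : (1 - 3 * ε) * ra⁻¹ ≤ ra⁻¹ * dist a b - |rb - ra| * ra⁻¹ := by
    have : (1 - 3 * ε) ≤ dist a b - |rb - ra| := by linarith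
    have hinv : 0 ≤ ra⁻¹ := inv_nonneg.2 hra0.le
    nlinarith
  have h7 : 1 - 4 * ε ≤ (1 - 3 * ε) * ra⁻¹ := by
    rw [← div_eq_mul_inv, le_div_iff₀ hra0]
    have h13 : 0 ≤ 1 - 3 * ε := by linarith
    nlinarith
  linarith

/-! ### The soft coordination cap -/

/-- **The soft coordination cap.** There is `ε₁₂ > 0` (with `ε₁₂ ≤ 1/4`) such that in every
finite configuration of points of `ℝ³` with pairwise distances `≥ 1 − ε₁₂`, every point has at
most twelve others within distance `1 + ε₁₂`.  (Thirteen such neighbours, radially projected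
from the centre, would be thirteen unit vectors pairwise at distance `≥ 1 − 4ε₁₂ ≥ 1 − δ`,
`δ` the kissing slack.) [folklore] -/
theorem exists_soft_cap : ∃ ε : ℝ, 0 < ε ∧ ε ≤ 1 / 4 ∧
    ∀ {N : ℕ} (x : Fin N → EuclideanSpace ℝ (Fin 3)),
    (∀ i j, i ≠ j → 1 - ε ≤ dist (x i) (x j)) → ∀ i : Fin N,
      Nat.card {j : Fin N // j ≠ i ∧ dist (x i) (x j) ≤ 1 + ε} ≤ 12 := by
  classical
  obtain ⟨δ, hδ, hslack⟩ := exists_kissing_slack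
  refine ⟨min (δ / 4) (1 / 4), lt_min (by positivity) (by norm_num), min_le_right _ _, ?_⟩
  intro N x hsep i
  set ε := min (δ / 4) (1 / 4) with hε_def
  have hε0 : 0 < ε := lt_min (by positivity) (by norm_num)
  have hε4 : ε ≤ 1 / 4 := min_le_right _ _
  have hεδ : 4 * ε ≤ δ := by
    have := min_le_left (δ / 4) (1 / 4)
    linarith
  by_contra hgt
  rw [not_le] at hgt
  set α := {j : Fin N // j ≠ i ∧ dist (x i) (x j) ≤ 1 + ε} with hα
  have h13 : 13 ≤ Fintype.card α := by
    rw [← Nat.card_eq_fintype_card]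
    exact hgt
  -- thirteen distinct near neighbours
  set emb : Fin 13 ↪ α := (Fin.castLEEmb h13).trans (Fintype.equivFin α).symm.toEmbedding
    with hemb
  set v : Fin 13 → EuclideanSpace ℝ (Fin 3) :=
    fun k => ‖x (emb k).1 - x i‖⁻¹ • (x (emb k).1 - x i) with hv
  have hshell : ∀ k : Fin 13, 1 - ε ≤ ‖x (emb k).1 - x i‖ ∧ ‖x (emb k).1 - x i‖ ≤ 1 + ε := by
    intro k
    have hk := (emb k).2
    rw [← dist_eq_norm, dist_comm]
    exact ⟨hsep _ _ hk.1.symm, hk.2⟩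
  have hnorm : ∀ k, ‖v k‖ = 1 := by
    intro k
    have h0 : 0 < ‖x (emb k).1 - x i‖ := by linarith [(hshell k).1]
    rw [hv]
    simp only
    rw [norm_smul, norm_inv, norm_norm, inv_mul_cancel₀ h0.ne']
  obtain ⟨k, l, hkl, hlt⟩ := hslack v hnorm
  have hne : (emb k).1 ≠ (emb l).1 := fun h => hkl (emb.injective (Subtype.ext h))
  have hd : 1 - ε ≤ dist (x (emb k).1 - x i) (x (emb l).1 - x i) := by
    rw [dist_sub_right]
    exact hsep _ _ hne
  have := dist_normalize_ge hε0.le hε4 (hshell k).1 (hshell k).2 (hshell l).1 (hshell l).2 hd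
  have hv' : dist (v k) (v l) =
      dist (‖x (emb k).1 - x i‖⁻¹ • (x (emb k).1 - x i))
        (‖x (emb l).1 - x i‖⁻¹ • (x (emb l).1 - x i)) := rfl
  rw [hv'] at hlt
  linarith

end Summit.AtomisticToContinuum.Crystallization.Theorems.MieRungCoordination

end
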